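import Summits.AnomalousDissipation.AnomalousDissipation.Theorems.TwoAndHalfDScalarLift2halfDRGlueTools

/-!
# Gluing weak sourced passive scalars in time at an `L²`-trace time

Summit-side helper file (everything proved) for the `2½`-dimensional scalar lift
(`Summit.AnomalousDissipation.AnomalousDissipation.Theses.TwoAndHalfD.ScalarLift2halfDR`): the
scalar counterpart of the tree's gluing of weak Navier–Stokes solutions
(`Literature/Analysis/FluidPDE/TorusWeakNSGluing`). If `θ₁` is a weak sourced scalar on
`[0, T₁)` (`Torus.IsWeakScalarTransportForcedOn`, drift `u`, source `s`, datum `θ₀`) satisfying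
the time-sliced weak identity at the time `σ ∈ (0, T₁)` for every smooth space–time field (the
`L²` trace identity, valid at a.e. `σ`; file `…Trace`), and `Θ` is a global weak sourced scalar
from the datum `θ₁ σ` over the translated drift `u(· + σ)` and source `s(· + σ)`, then
`t ↦ θ₁ t` (`t ≤ σ`), `Θ (t - σ)` (`t > σ`) is a global weak sourced scalar from `θ₀`
(`isWeakScalarTransportForced_glue`).
-/

noncomputable section

open MeasureTheory Set Filter Topology Function UnitAddTorus
open scoped ENNReal NNReal InnerProductSpace ContDiff
open Literature.Analysis.FunctionSpaces Literature.Analysis.FunctionSpaces.Torus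
open Literature.Analysis.FluidPDE Literature.Analysis.FluidPDE.Torus

namespace Summit.AnomalousDissipation.AnomalousDissipation.Theorems

set_option linter.dupNamespace false

section Glue

variable {d : Type*} [Fintype d]
variable {T κ : ℝ} {u : ℝ → UnitAddTorus d → EuclideanSpace ℝ d} {s : ℝ → UnitAddTorus d → ℝ}
  {θ₀ : UnitAddTorus d → ℝ} {θ : ℝ → UnitAddTorus d → ℝ}

/-! ### The glued weak sourced scalar -/

/-- **Gluing weak sourced scalars at an `L²`-trace time, finite horizon.** Let `θ₁` be a weak
sourced scalar on `[0, T₁)` (drift `u`, source `s`, datum `θ₀`) satisfying at `σ ∈ (0, T₁)` the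
time-sliced weak identity `∫ θ₁(σ) ψ(σ) = ∫ θ₀ ψ(0) + ∫_{(0,σ]} (∫ θ₁ (∂ₜψ + u·∇ψ + κΔψ) + ∫ s ψ)`
for every smooth space–time `ψ`, and let `Θ` be a weak sourced scalar on `[0, T - σ)` from the
datum `θ₁ σ` over `u(· + σ)`, `s(· + σ)`, `σ < T`. Then `t ↦ θ₁ t` (`t ≤ σ`), `Θ (t - σ)`
(`t > σ`) is a weak sourced scalar on `[0, T)` from `θ₀`: the class bookkeeping splits at `σ`
and translates; in the weak identity the piece on `(0, σ]` is `∫ θ₁(σ) ψ(σ) - ∫ θ₀ ψ(0)` by the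
trace identity and the piece on `(σ, T)` is `-∫ θ₁(σ) ψ(σ)` by the weak identity of `Θ`
against `ψ(· + σ)` (Cheskidov–Luo 2022, §2.6, scalar version; tree: `TorusWeakNSGluing`). [folklore] -/
theorem isWeakScalarTransportForcedOn_glue {T₁ σ : ℝ} {θ₁ Θ : ℝ → UnitAddTorus d → ℝ}
    (hσ0 : 0 < σ) (hσ1 : σ < T₁) (hσT : σ < T)
    (h₁ : IsWeakScalarTransportForcedOn T₁ κ u s θ₀ θ₁)
    (htr : ∀ ψ : ℝ → UnitAddTorus d → ℝ, ContDiff ℝ ∞ (stLift ψ) →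
      ∫ x, θ₁ σ x * ψ σ x = (∫ x, θ₀ x * ψ 0 x) +
        ∫ t in Ioc 0 σ, ((∫ x, θ₁ t x * (Torus.timeDeriv ψ t x + ⟪u t x, Torus.gradient (ψ t) x⟫_ℝ +
          κ * Torus.laplacian (ψ t) x)) + ∫ x, s t x * ψ t x))
    (hΘ : IsWeakScalarTransportForcedOn (T - σ) κ (fun t => u (t + σ)) (fun t => s (t + σ)) (θ₁ σ) Θ) :
    IsWeakScalarTransportForcedOn T κ u s θ₀ (fun t => if t ≤ σ then θ₁ t else Θ (t - σ)) := by
  set θg : ℝ → UnitAddTorus d → ℝ := fun t => if t ≤ σ then θ₁ t else Θ (t - σ) with hθg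
  have hsub1 : Ioc (0 : ℝ) σ ⊆ Ioo 0 T₁ := Ioc_subset_Ioo_right hσ1
  have hva : ∀ t ∈ Ioc (0 : ℝ) σ, θg t = θ₁ t := fun t ht => by simp [hθg, ht.2]
  have hwa : ∀ t ∈ Ioo σ T, θg t = Θ (t - σ) := fun t ht => by simp [hθg, not_le.2 ht.1]
  have hμ1 : volume.restrict (Ioc (0 : ℝ) σ ×ˢ (univ : Set (EuclideanSpace ℝ d))) ≤
      volume.restrict (Ioo 0 T₁ ×ˢ univ) := Measure.restrict_mono (prod_mono hsub1 subset_rfl) le_rfl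
  -- ### measurability
  have hm : AEStronglyMeasurable (stLift θg) (volume.restrict (Ioo 0 T ×ˢ univ)) :=
    aestronglyMeasurable_stLift_glue' hσ0.le hσT (h₁.aestronglyMeasurable.mono_measure hμ1)
      hΘ.aestronglyMeasurable
  have hmu : AEStronglyMeasurable (stLift u) (volume.restrict (Ioo 0 T ×ˢ univ)) := by
    have h := aestronglyMeasurable_stLift_glue' hσ0.le hσT
      (h₁.aestronglyMeasurable_velocity.mono_measure hμ1) hΘ.aestronglyMeasurable_velocity
    have e : (fun t => if t ≤ σ then u t else u (t - σ + σ)) = u := by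
      funext t; simp only [sub_add_cancel, ite_self]
    rwa [e] at h
  have hms : AEStronglyMeasurable (stLift s) (volume.restrict (Ioo 0 T ×ˢ univ)) := by
    have h := aestronglyMeasurable_stLift_glue' hσ0.le hσT
      (h₁.aestronglyMeasurable_source.mono_measure hμ1) hΘ.aestronglyMeasurable_source
    have e : (fun t => if t ≤ σ then s t else s (t - σ + σ)) = s := by
      funext t; simp only [sub_add_cancel, ite_self]
    rwa [e] at h
  -- ### the `L^∞_t L²_x` bound
  obtain ⟨C₁, hC₁⟩ := h₁.ae_lintegral_sq_le
  obtain ⟨C₂, hC₂⟩ := hΘ.ae_lintegral_sq_le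
  have hbound : ∀ᵐ t ∂(volume.restrict (Ioo 0 T)), ∫⁻ x, ‖θg t x‖ₑ ^ 2 ≤ ((max C₁ C₂ : ℝ≥0) : ℝ≥0∞) := by
    refine ae_restrict_Ioo_of_split hσ0.le hσT ?_ ?_
    · filter_upwards [ae_restrict_of_ae_restrict_of_subset hsub1 hC₁, ae_restrict_mem measurableSet_Ioc]
        with t ht htI
      rw [hva t htI]
      exact ht.trans (ENNReal.coe_le_coe.2 (le_max_left _ _))
    · have h2 := ae_restrict_Ioo_comp_sub_right' (a := σ) (T := T) hC₂
      filter_upwards [h2, ae_restrict_mem measurableSet_Ioo] with t ht htI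
      rw [hwa t htI]
      exact ht.trans (ENNReal.coe_le_coe.2 (le_max_right _ _))
  -- ### integrals in time: split at `σ` and translate
  have hvel : ∫⁻ t in Ioo 0 T, (∫⁻ x, ‖u t x‖ₑ ^ 2) ^ (1 / 2 : ℝ) < ⊤ := by
    refine setLIntegral_Ioo_lt_top_of_split hσ0.le hσT
      ((lintegral_mono_set hsub1).trans_lt h₁.lintegral_velocity_lt_top) ?_
    calc ∫⁻ t in Ioo σ T, (∫⁻ x, ‖u t x‖ₑ ^ 2) ^ (1 / 2 : ℝ)
        = ∫⁻ t in Ioo σ T, (∫⁻ x, ‖u (t - σ + σ) x‖ₑ ^ 2) ^ (1 / 2 : ℝ) := by simp only [sub_add_cancel]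
      _ = ∫⁻ t in Ioo 0 (T - σ), (∫⁻ x, ‖u (t + σ) x‖ₑ ^ 2) ^ (1 / 2 : ℝ) :=
          setLIntegral_Ioo_comp_sub_right' (fun t => (∫⁻ x, ‖u (t + σ) x‖ₑ ^ 2) ^ (1 / 2 : ℝ)) σ T
      _ < ⊤ := hΘ.lintegral_velocity_lt_top
  have hmul : ∫⁻ t in Ioo 0 T, ∫⁻ x, ‖u t x‖ₑ * ‖θg t x‖ₑ < ⊤ := by
    refine setLIntegral_Ioo_lt_top_of_split hσ0.le hσT ?_ ?_
    · calc ∫⁻ t in Ioc 0 σ, ∫⁻ x, ‖u t x‖ₑ * ‖θg t x‖ₑ = ∫⁻ t in Ioc 0 σ, ∫⁻ x, ‖u t x‖ₑ * ‖θ₁ t x‖ₑ :=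
            setLIntegral_congr_fun measurableSet_Ioc fun t ht => by rw [hva t ht]
        _ ≤ ∫⁻ t in Ioo 0 T₁, ∫⁻ x, ‖u t x‖ₑ * ‖θ₁ t x‖ₑ := lintegral_mono_set hsub1
        _ < ⊤ := h₁.lintegral_mul_lt_top
    · calc ∫⁻ t in Ioo σ T, ∫⁻ x, ‖u t x‖ₑ * ‖θg t x‖ₑ
            = ∫⁻ t in Ioo σ T, ∫⁻ x, ‖u (t - σ + σ) x‖ₑ * ‖Θ (t - σ) x‖ₑ :=
            setLIntegral_congr_fun measurableSet_Ioo fun t ht => by rw [hwa t ht, sub_add_cancel]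
        _ = ∫⁻ t in Ioo 0 (T - σ), ∫⁻ x, ‖u (t + σ) x‖ₑ * ‖Θ t x‖ₑ :=
            setLIntegral_Ioo_comp_sub_right' (fun t => ∫⁻ x, ‖u (t + σ) x‖ₑ * ‖Θ t x‖ₑ) σ T
        _ < ⊤ := hΘ.lintegral_mul_lt_top
  have hsrc : ∫⁻ t in Ioo 0 T, ∫⁻ x, ‖s t x‖ₑ < ⊤ := by
    refine setLIntegral_Ioo_lt_top_of_split hσ0.le hσT
      ((lintegral_mono_set hsub1).trans_lt h₁.lintegral_source_lt_top) ?_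
    calc ∫⁻ t in Ioo σ T, ∫⁻ x, ‖s t x‖ₑ = ∫⁻ t in Ioo σ T, ∫⁻ x, ‖s (t - σ + σ) x‖ₑ := by
          simp only [sub_add_cancel]
      _ = ∫⁻ t in Ioo 0 (T - σ), ∫⁻ x, ‖s (t + σ) x‖ₑ :=
          setLIntegral_Ioo_comp_sub_right' (fun t => ∫⁻ x, ‖s (t + σ) x‖ₑ) σ T
      _ < ⊤ := hΘ.lintegral_source_lt_top
  -- ### weak incompressibility
  have hdiv : ∀ᵐ t ∂(volume.restrict (Ioo 0 T)), IsWeaklyDivFree (u t) := by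
    refine ae_restrict_Ioo_of_split hσ0.le hσT
      (ae_restrict_of_ae_restrict_of_subset hsub1 h₁.ae_isWeaklyDivFree) ?_
    have h2 := ae_restrict_Ioo_comp_sub_right' (a := σ) (T := T) hΘ.ae_isWeaklyDivFree
    filter_upwards [h2] with t ht
    simpa only [sub_add_cancel] using ht
  refine ⟨hm, hmu, hms, ⟨max C₁ C₂, hbound⟩, hvel, hmul, hsrc, hdiv, fun ψ hψ => ?_⟩
  -- ### the weak identity against a test `ψ` on `[0, T)`
  obtain ⟨ψc, hψc, hψeq⟩ :=
    exists_isSpaceTimeTest_eq_of_lt (T := T₁) (a := (σ + T₁) / 2) (by linarith) hψ.1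
  have hσa : σ < (σ + T₁) / 2 := by linarith
  -- the functionals of the glued field
  set A : ℝ → ℝ := fun t => ∫ x, θg t x * (Torus.timeDeriv ψ t x + ⟪u t x, Torus.gradient (ψ t) x⟫_ℝ +
    κ * Torus.laplacian (ψ t) x) with hA
  set S : ℝ → ℝ := fun t => ∫ x, s t x * ψ t x with hS
  -- on `(0, σ]`: the functionals of `θ₁` against the cutoff `ψc`
  set A₁ : ℝ → ℝ := fun t => ∫ x, θ₁ t x * (Torus.timeDeriv ψc t x + ⟪u t x, Torus.gradient (ψc t) x⟫_ℝ +
    κ * Torus.laplacian (ψc t) x) with hA₁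
  set S₁ : ℝ → ℝ := fun t => ∫ x, s t x * ψc t x with hS₁
  have hA1 : ∀ t ∈ Ioc (0 : ℝ) σ, A t = A₁ t := by
    intro t ht
    obtain ⟨e1, e2⟩ := hψeq t (ht.2.trans_lt hσa)
    simp only [hA, hA₁, hva t ht, e1, e2]
  have hS1 : ∀ t ∈ Ioc (0 : ℝ) σ, S t = S₁ t := by
    intro t ht
    simp only [hS, hS₁, (hψeq t (ht.2.trans_lt hσa)).1]
  have hA1i' : IntegrableOn A₁ (Ioo 0 T₁) := (h₁.integrable_weakIntegrand hψc).integral_prod_left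
  have hS1i' : IntegrableOn S₁ (Ioo 0 T₁) := (h₁.integrable_source_mul_test hψc).integral_prod_left
  have hA1i : IntegrableOn A (Ioc 0 σ) :=
    (hA1i'.mono_set hsub1).congr_fun (fun t ht => (hA1 t ht).symm) measurableSet_Ioc
  have hS1i : IntegrableOn S (Ioc 0 σ) :=
    (hS1i'.mono_set hsub1).congr_fun (fun t ht => (hS1 t ht).symm) measurableSet_Ioc
  -- on `(σ, T)`: the functionals of `Θ` against the translate `ψ(· + σ)`
  set ψ' : ℝ → UnitAddTorus d → ℝ := fun τ => ψ (τ + σ) with hψ'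
  have hψ't : IsSpaceTimeTest (T - σ) ψ' := hψ.comp_add_right σ
  set A₂ : ℝ → ℝ := fun τ => ∫ x, Θ τ x * (Torus.timeDeriv ψ' τ x + ⟪u (τ + σ) x, Torus.gradient (ψ' τ) x⟫_ℝ +
    κ * Torus.laplacian (ψ' τ) x) with hA₂
  set S₂ : ℝ → ℝ := fun τ => ∫ x, s (τ + σ) x * ψ' τ x with hS₂
  have hA2 : ∀ t ∈ Ioo σ T, A t = A₂ (t - σ) := by
    intro t ht
    have hts : ψ t = ψ' (t - σ) := by simp only [hψ', sub_add_cancel]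
    have htd : ∀ x, Torus.timeDeriv ψ t x = Torus.timeDeriv ψ' (t - σ) x := by
      intro x
      rw [hψ', timeDeriv_comp_add_right ψ σ (t - σ) x, sub_add_cancel]
    simp only [hA, hA₂, hwa t ht, sub_add_cancel]
    refine integral_congr_ae (ae_of_all _ fun x => ?_)
    beta_reduce
    rw [htd x, hts]
  have hS2 : ∀ t ∈ Ioo σ T, S t = S₂ (t - σ) := by
    intro t ht
    simp only [hS, hS₂, hψ', sub_add_cancel]
  have hA2i' : IntegrableOn A₂ (Ioo 0 (T - σ)) := (hΘ.integrable_weakIntegrand hψ't).integral_prod_left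
  have hS2i' : IntegrableOn S₂ (Ioo 0 (T - σ)) := (hΘ.integrable_source_mul_test hψ't).integral_prod_left
  have hA2i : IntegrableOn A (Ioo σ T) :=
    (integrableOn_Ioo_comp_sub_right (T := T) hA2i').congr_fun (fun t ht => (hA2 t ht).symm)
      measurableSet_Ioo
  have hS2i : IntegrableOn S (Ioo σ T) :=
    (integrableOn_Ioo_comp_sub_right (T := T) hS2i').congr_fun (fun t ht => (hS2 t ht).symm)
      measurableSet_Ioo
  -- ### the identities of the pieces
  have hΘ_id : (∫ τ in Ioo 0 (T - σ), A₂ τ) + (∫ τ in Ioo 0 (T - σ), S₂ τ) + ∫ x, θ₁ σ x * ψ σ x = 0 := by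
    have h := hΘ.weak_eq ψ' hψ't
    have e0 : ψ' 0 = ψ σ := by simp only [hψ', zero_add]
    rw [e0] at h
    exact h
  have h₁_id : (∫ t in Ioc 0 σ, A t) + (∫ t in Ioc 0 σ, S t) =
      (∫ x, θ₁ σ x * ψ σ x) - ∫ x, θ₀ x * ψ 0 x := by
    have h := htr ψ hψ.1
    rw [← integral_add hA1i hS1i, setIntegral_congr_fun measurableSet_Ioc (fun t ht =>
      show A t + S t = (∫ x, θ₁ t x * (Torus.timeDeriv ψ t x + ⟪u t x, Torus.gradient (ψ t) x⟫_ℝ +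
        κ * Torus.laplacian (ψ t) x)) + ∫ x, s t x * ψ t x by simp only [hA, hS, hva t ht])]
    linarith
  -- ### assembling
  have hTa : Ioo 0 T = Ioc 0 σ ∪ Ioo σ T := (Ioc_union_Ioo_eq_Ioo hσ0.le hσT).symm
  have hdisj : Disjoint (Ioc (0 : ℝ) σ) (Ioo σ T) := (Ioc_disjoint_Ioi (le_refl σ)).mono_right Ioo_subset_Ioi_self
  have eA : ∫ t in Ioo 0 T, A t = (∫ t in Ioc 0 σ, A t) + ∫ τ in Ioo 0 (T - σ), A₂ τ := by
    rw [hTa, setIntegral_union hdisj measurableSet_Ioo hA1i hA2i,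
      setIntegral_congr_fun measurableSet_Ioo (fun t ht => hA2 t ht), setIntegral_Ioo_comp_sub_right A₂ σ T]
  have eS : ∫ t in Ioo 0 T, S t = (∫ t in Ioc 0 σ, S t) + ∫ τ in Ioo 0 (T - σ), S₂ τ := by
    rw [hTa, setIntegral_union hdisj measurableSet_Ioo hS1i hS2i,
      setIntegral_congr_fun measurableSet_Ioo (fun t ht => hS2 t ht), setIntegral_Ioo_comp_sub_right S₂ σ T]
  change (∫ t in Ioo 0 T, A t) + (∫ t in Ioo 0 T, S t) + ∫ x, θ₀ x * ψ 0 x = 0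
  rw [eA, eS]
  linarith [hΘ_id, h₁_id]

/-- **Gluing weak sourced scalars at an `L²`-trace time, global form**: with `θ₁` as above on
`[0, T₁)`, `σ ∈ (0, T₁)` a trace time, and `Θ` a GLOBAL weak sourced scalar from `θ₁ σ` over
`u(· + σ)`, `s(· + σ)`, the glued field is a global weak sourced scalar from `θ₀` (horizons
`T ≤ σ` by restriction of `θ₁`, horizons `T > σ` by `isWeakScalarTransportForcedOn_glue`). [folklore] -/
theorem isWeakScalarTransportForced_glue {T₁ σ : ℝ} {θ₁ Θ : ℝ → UnitAddTorus d → ℝ}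
    (hσ0 : 0 < σ) (hσ1 : σ < T₁)
    (h₁ : IsWeakScalarTransportForcedOn T₁ κ u s θ₀ θ₁)
    (htr : ∀ ψ : ℝ → UnitAddTorus d → ℝ, ContDiff ℝ ∞ (stLift ψ) →
      ∫ x, θ₁ σ x * ψ σ x = (∫ x, θ₀ x * ψ 0 x) +
        ∫ t in Ioc 0 σ, ((∫ x, θ₁ t x * (Torus.timeDeriv ψ t x + ⟪u t x, Torus.gradient (ψ t) x⟫_ℝ +
          κ * Torus.laplacian (ψ t) x)) + ∫ x, s t x * ψ t x))
    (hΘ : IsWeakScalarTransportForced κ (fun t => u (t + σ)) (fun t => s (t + σ)) (θ₁ σ) Θ) :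
    IsWeakScalarTransportForced κ u s θ₀ (fun t => if t ≤ σ then θ₁ t else Θ (t - σ)) := by
  intro T hT
  rcases le_or_gt T σ with hTσ | hTσ
  · refine isWeakScalarTransportForcedOn_congr (isWeakScalarTransportForcedOn_of_le h₁ (hTσ.trans hσ1.le)) ?_
    intro t ht
    simp [ht.2.le.trans hTσ]
  · exact isWeakScalarTransportForcedOn_glue hσ0 hσ1 hTσ h₁ htr (hΘ (T - σ) (sub_pos.2 hTσ))

end Glue

end Summit.AnomalousDissipation.AnomalousDissipation.Theorems

end
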